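import Summits.QuantumAdvantage.QuantumAdvantage.Theorems.NearExactIsExact.Negative.ProductTest
import Summits.QuantumAdvantage.QuantumAdvantage.Theorems.NearExactIsExact.Negative.RMDual

/-!
# `NearExactIsExact` (stmt-QuantumAdvantage-14043) — OBSERVATION B in Lean: degree of `π` on the residual flat, and the hypotheses of LEMMA S13

BQ-s habitat of the crux (b2b cell, DISPROOF §10.4, §24.4, §27): `π, τ` mutually inverse coordinatewise-quadratic
maps of `𝔽₂ˢ`, `c₁, c₂` cubic, and the residual `c₁ ⊕ c₂∘π` equal to the indicator `U` of the image of a map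
`e : 𝔽₂^m → 𝔽₂ˢ` admitting a coordinatewise-affine retraction `ρ` (for the habitat: `U` a flat of dimension
`m = s − 6`, `e` an affine parametrisation). Combining the product test (`Negative.ProductTest`) with Reed–Muller
duality on the flat (`Negative.RMDual`):

* `isDegLeFun_comp_param` (**OBSERVATION B**, DISPROOF §24.4, all `s`): for `q` of degree `≤ d₂`,
  `deg (q ∘ π ∘ e) ≤ k` whenever `m ≤ d₁ + k + 1`, `3 + d₁ + 2d₂ < s`, `3 + d₂ + 2d₁ < s`;
* at `s = 13`, `m = 7` — the three hypotheses of **LEMMA S13** (DISPROOF §27.2; its conclusion "`π ∘ e` is affine"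
  is proved on paper + two exhaustive machine checks, not here):
  (V1) `s13_V1`: `q` affine ⇒ `deg (q ∘ π ∘ e) ≤ 2` — the components of `π|_U` are QUADRATIC;
  (V3) `s13_V3`: `q` quadratic ⇒ `deg (q ∘ π ∘ e) ≤ 3` — pairwise products of components are CUBIC;
  (V4) `s13_V4`: `q` cubic ⇒ `deg (q ∘ π ∘ e) ≤ 3` — triple products of components are CUBIC.

HONEST FRAMING: THEOREMS about one finite habitat of the crux (kernel-checked), NOT summit progress.
Sources (orientation only): MacWilliams–Sloane (1977) Ch. 13–14; everything is proved in the tree; standard axioms.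
-/

set_option linter.dupNamespace false -- D-0017: single-problem summit ⇒ `QuantumAdvantage.QuantumAdvantage` by design

namespace Summit.QuantumAdvantage.QuantumAdvantage.Theorems.NearExactIsExact.Negative.ProductTestDegree

open Finset
open Literature.Computability.QuantumComplexity
open Summit.QuantumAdvantage.QuantumAdvantage.Theorems.NearExactIsExact.Negative.ProductTest (productTest_support)
open Summit.QuantumAdvantage.QuantumAdvantage.Theorems.NearExactIsExact.Negative.RMDual
  (isDegLeFun_restrict_of_orthogonal)

/-- **OBSERVATION B** (degree of `π` along the residual support, all `s`). In the BQ-s setting, if the residual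
`c₁ ⊕ c₂∘π` is the indicator of `e(𝔽₂^m)` (`ρ` a coordinatewise-affine retraction of `e`), then for every `q`
of degree `≤ d₂` the function `q ∘ π ∘ e` on `𝔽₂^m` has degree `≤ k`, provided `m ≤ d₁ + k + 1`,
`3 + d₁ + 2d₂ < s` and `3 + d₂ + 2d₁ < s`. [folklore] -/
theorem isDegLeFun_comp_param {s m d₁ d₂ k : ℕ} (hk : m ≤ d₁ + k + 1)
    (hs₁ : 3 + d₁ + 2 * d₂ < s) (hs₂ : 3 + d₂ + 2 * d₁ < s)
    (π τ : (Fin s → Bool) → (Fin s → Bool))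
    (hπ : ∀ i, IsDegLeFun 2 (fun y => π y i)) (hτ : ∀ i, IsDegLeFun 2 (fun x => τ x i))
    (hτπ : ∀ y, τ (π y) = y) (hπτ : ∀ x, π (τ x) = x)
    (c₁ c₂ : (Fin s → Bool) → Bool) (h₁ : IsDegLeFun 3 c₁) (h₂ : IsDegLeFun 3 c₂)
    (e : (Fin m → Bool) → (Fin s → Bool)) (ρ : (Fin s → Bool) → (Fin m → Bool))
    (hρ : ∀ j, IsDegLeFun 1 (fun y => ρ y j)) (hρe : ∀ u, ρ (e u) = u)
    (U : (Fin s → Bool) → Bool) (hU : ∀ y, U y = true ↔ ∃ u, e u = y)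
    (hres : ∀ y, (c₁ y ^^ c₂ (π y)) = U y)
    (q : (Fin s → Bool) → Bool) (hq : IsDegLeFun d₂ q) :
    IsDegLeFun k (fun u => q (π (e u))) :=
  isDegLeFun_restrict_of_orthogonal hk e ρ hρ hρe U (fun y => q (π y)) hU fun P hP =>
    productTest_support π τ hπ hτ hτπ hπτ c₁ c₂ U h₁ h₂ hres P q hP hq hs₁ hs₂

/-- **(V1) of LEMMA S13** (`s = 13`, `m = 7`, test `(d₁,d₂) = (4,1)`): for affine `q`, `q ∘ π ∘ e` is quadratic —
every component of `π` restricted to the residual 7-flat has degree `≤ 2`. [folklore] -/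
theorem s13_V1 (π τ : (Fin 13 → Bool) → (Fin 13 → Bool))
    (hπ : ∀ i, IsDegLeFun 2 (fun y => π y i)) (hτ : ∀ i, IsDegLeFun 2 (fun x => τ x i))
    (hτπ : ∀ y, τ (π y) = y) (hπτ : ∀ x, π (τ x) = x)
    (c₁ c₂ : (Fin 13 → Bool) → Bool) (h₁ : IsDegLeFun 3 c₁) (h₂ : IsDegLeFun 3 c₂)
    (e : (Fin 7 → Bool) → (Fin 13 → Bool)) (ρ : (Fin 13 → Bool) → (Fin 7 → Bool))
    (hρ : ∀ j, IsDegLeFun 1 (fun y => ρ y j)) (hρe : ∀ u, ρ (e u) = u)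
    (U : (Fin 13 → Bool) → Bool) (hU : ∀ y, U y = true ↔ ∃ u, e u = y)
    (hres : ∀ y, (c₁ y ^^ c₂ (π y)) = U y)
    (q : (Fin 13 → Bool) → Bool) (hq : IsDegLeFun 1 q) :
    IsDegLeFun 2 (fun u => q (π (e u))) :=
  isDegLeFun_comp_param (d₁ := 4) (by norm_num) (by norm_num) (by norm_num)
    π τ hπ hτ hτπ hπτ c₁ c₂ h₁ h₂ e ρ hρ hρe U hU hres q hq

/-- **(V3) of LEMMA S13** (test `(3,2)`): for quadratic `q` — in particular a product of two affine functions —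
`q ∘ π ∘ e` is cubic: pairwise products of components of `π` on the residual 7-flat have degree `≤ 3`. [folklore] -/
theorem s13_V3 (π τ : (Fin 13 → Bool) → (Fin 13 → Bool))
    (hπ : ∀ i, IsDegLeFun 2 (fun y => π y i)) (hτ : ∀ i, IsDegLeFun 2 (fun x => τ x i))
    (hτπ : ∀ y, τ (π y) = y) (hπτ : ∀ x, π (τ x) = x)
    (c₁ c₂ : (Fin 13 → Bool) → Bool) (h₁ : IsDegLeFun 3 c₁) (h₂ : IsDegLeFun 3 c₂)
    (e : (Fin 7 → Bool) → (Fin 13 → Bool)) (ρ : (Fin 13 → Bool) → (Fin 7 → Bool))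
    (hρ : ∀ j, IsDegLeFun 1 (fun y => ρ y j)) (hρe : ∀ u, ρ (e u) = u)
    (U : (Fin 13 → Bool) → Bool) (hU : ∀ y, U y = true ↔ ∃ u, e u = y)
    (hres : ∀ y, (c₁ y ^^ c₂ (π y)) = U y)
    (q : (Fin 13 → Bool) → Bool) (hq : IsDegLeFun 2 q) :
    IsDegLeFun 3 (fun u => q (π (e u))) :=
  isDegLeFun_comp_param (d₁ := 3) (by norm_num) (by norm_num) (by norm_num)
    π τ hπ hτ hτπ hπτ c₁ c₂ h₁ h₂ e ρ hρ hρe U hU hres q hq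

/-- **(V4) of LEMMA S13** (test `(3,3)`): for cubic `q` — in particular a product of three affine functions —
`q ∘ π ∘ e` is STILL cubic: triple products of components of `π` on the residual 7-flat have degree `≤ 3`
(the condition that excludes the half-affine placements in the paper proof, DISPROOF §27.3 Steps 6–7). [folklore] -/
theorem s13_V4 (π τ : (Fin 13 → Bool) → (Fin 13 → Bool))
    (hπ : ∀ i, IsDegLeFun 2 (fun y => π y i)) (hτ : ∀ i, IsDegLeFun 2 (fun x => τ x i))
    (hτπ : ∀ y, τ (π y) = y) (hπτ : ∀ x, π (τ x) = x)
    (c₁ c₂ : (Fin 13 → Bool) → Bool) (h₁ : IsDegLeFun 3 c₁) (h₂ : IsDegLeFun 3 c₂)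
    (e : (Fin 7 → Bool) → (Fin 13 → Bool)) (ρ : (Fin 13 → Bool) → (Fin 7 → Bool))
    (hρ : ∀ j, IsDegLeFun 1 (fun y => ρ y j)) (hρe : ∀ u, ρ (e u) = u)
    (U : (Fin 13 → Bool) → Bool) (hU : ∀ y, U y = true ↔ ∃ u, e u = y)
    (hres : ∀ y, (c₁ y ^^ c₂ (π y)) = U y)
    (q : (Fin 13 → Bool) → Bool) (hq : IsDegLeFun 3 q) :
    IsDegLeFun 3 (fun u => q (π (e u))) :=
  isDegLeFun_comp_param (d₁ := 3) (by norm_num) (by norm_num) (by norm_num)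
    π τ hπ hτ hτπ hπτ c₁ c₂ h₁ h₂ e ρ hρ hρe U hU hres q hq

end Summit.QuantumAdvantage.QuantumAdvantage.Theorems.NearExactIsExact.Negative.ProductTestDegree
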